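import Summits.BirchSwinnertonDyer.BirchSwinnertonDyer.Theorems.ManinLocalTwoThreeTameCellLocalTwoTorsionHolds
import Literature.NumberTheory.EllipticCurves.PAdicHeightsTateValuationProofs
import HarnessLib

/-!
# The tame `IV*` stratum at `2`: the Vélu `B` of every rational `2`-torsion point is a `2`-adic UNIT
# (E-an-120's `IV*` half in valuation form: `K₂ = 8`, i.e. `ord₂ B = 0`)

Summit `BirchSwinnertonDyer`, route `ManinLocalTwoThree` (cell bsd-f2-manin), deciding crux C2 `ManinOddAtFour`
(stmt-BirchSwinnertonDyer-22967); the `2`-adic twin of `…TameThreeNeronScalarIIIstar` (p642603) for the Γ₀/Γ₁ DOUBLING ledger at `4p`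
(p3-g6 `velu_two_of_doubled_four_mul_prime`: doubling `|c₀| = 2|c₁|` forces `W₁` to carry the `u = 1` Vélu `2`-pair of `W₀` at a
rational `2`-torsion abscissa `q`).  THE STATEMENT (`norm_veluB_eq_one_of_IVstar`, `padicValRat_veluB_eq_zero_of_IVstar`): for `W/ℚ`
globally minimal, TAME at `2` (`4 ∥ N`) with `ord₂ Δ_min = 8` (Kodaira `IV*`) and `q` with `Ψ₂²_W(q − b₂/12) = 0`, the Vélu quantity
`B = 3q² − c₄/48` (= `(6x² + b₂x + b₄)/2` at the torsion abscissa `x = q − b₂/12`; the tree's `velu_B_identity`) is a `2`-ADIC UNIT.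
With `…VeluTwoDiscriminant.padicValRat_velu_two_Δ` (`ord₂ Δ(T) + 3·ord₂ B = 2·ord₂ Δ(W) = 16` for every carrier `T` of the pair)
this pins `ord₂ Δ(T) = 16` — incompatible with a tame carrier (`ord₂ Δ_min ∈ {4, 8}`): no doubling on the `IV*` stratum at `4p`
(sequel file).

THE PROOF (the lead's E-imc-75 pipeline, `…TameCellLocalTwoTorsionHolds`): Kodaira `IV*` at `2` (`kodairaSymbolAt_of_four_dvd_conductorNorm`),
read over `ℤ₂` (`kodairaSymbolAt_eq_padic`), Tate's normal form `[2α, 4α₂, 4α₃, 8α₄, 16α₆]`, `α₃ ∈ ℤ₂ˣ`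
(`exists_IVstarNormalForm_padicInt`) reached by a change of variables `C` over `ℚ₂` with `‖u(C)‖₂ = 1` (both models have
`ord₂ Δ = 8`); the torsion abscissa becomes a root `x₁` of the `IV*`-cubic `x³ + (α² + 4α₂)x² + 4(2α₄ + αα₃)x + 4(α₃² + 4α₆)`
(`twoDivision_root_smul`, `IVstarCubic_eq_zero_of_twoDivision_root`), and EVERY `ℚ₂`-root of that cubic is a UNIT
(`norm_eq_one_of_IVstarCubic_root_padicInt`, the root analysis of `root_unique_of_IVstarCubic_padicInt` re-run: no root if `2 ∣ α`;
for `α` odd no root of norm `≤ 1/4` or `= 1/2` — the mod-`4` argument); so `B` read on the normal form, `3x₁² + 2(α² + 4α₂)x₁ + 4(…)`,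
is odd, and `B` transforms by `u⁻⁴` (the `b`'s depend on `u, r` only).

HONEST FRAMING: a LOCAL theorem; C2, Manin's conjecture and BSD are not proved.  No definitions, no named facts, no sorry.
References: [SilvermanATAEC1994] IV.9.4 (steps 2, 6, 8), Table 4.1; [SilvermanAEC2009] III.1 Table 3.1, III.4.5; HOME/MEMO-an.md §67
(E-an-120 / E-an-119: `IV*`: `m = 7`, `K = 8`, `u = 2`, census 32 073 / 0).
-/

set_option autoImplicit false
set_option linter.dupNamespace false

noncomputable section

open scoped Classical
open Polynomial IsLocalRing WeierstrassCurve
open IsDiscreteValuationRing hiding maximalIdeal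
open Literature.NumberTheory.DiophantineGeometry Literature.NumberTheory.DiophantineGeometry.TateAlgorithm

namespace Summit.BirchSwinnertonDyer.BirchSwinnertonDyer.Theorems.ManinLocalTwoThree

/-! ### §1 Every `ℚ₂`-root of the `IV*`-cubic is a unit -/

/-- **Every `ℚ₂`-root of the `IV*`-cubic is a `2`-adic unit.**  For `α, α₂, α₃, α₄, α₆ ∈ ℤ₂` with `α₃` a unit, a root `t ∈ ℚ₂` of
`x³ + (α² + 4α₂)x² + 4(2α₄ + αα₃)x + 4(α₃² + 4α₆)` has `‖t‖₂ = 1` (no root at all if `2 ∣ α`; for `α` odd: `t` is integral, and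
`‖t‖ ≤ 1/4` or `‖t‖ = 1/2` are impossible — the constant term `4(α₃² + 4α₆)` has norm exactly `1/4`, and `t = 2w` with `w` a unit
contradicts the equation mod `4`).  Re-run of the root analysis of `root_unique_of_IVstarCubic_padicInt`.
[cite: SilvermanATAEC1994, IV.9.4 (step 8)] -/
theorem norm_eq_one_of_IVstarCubic_root_padicInt {α α₂ α₃ α₄ α₆ : ℤ_[2]} (hα₃ : IsUnit α₃) {t : ℚ_[2]}
    (ht : t ^ 3 + ((α ^ 2 + 4 * α₂ : ℤ_[2]) : ℚ_[2]) * t ^ 2 + ((4 * (2 * α₄ + α * α₃) : ℤ_[2]) : ℚ_[2]) * t +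
      ((4 * (α₃ ^ 2 + 4 * α₆) : ℤ_[2]) : ℚ_[2]) = 0) : ‖t‖ = 1 := by
  -- adapted from `…TameCellIVstarPadicNormalForm.root_unique_of_IVstarCubic_padicInt` (lead p1)
  have h2n : ‖((2 : ℤ_[2]) : ℚ_[2])‖ = 1 / 2 := by
    have e : ((2 : ℤ_[2]) : ℚ_[2]) = 2 := by exact_mod_cast PadicInt.coe_natCast 2
    rw [e]; have := Padic.norm_p (p := 2); norm_num at this ⊢; exact_mod_cast this
  have hm1 : ∀ m : ℤ_[2], ‖(m : ℚ_[2])‖ ≤ 1 := fun m => by rw [← PadicInt.norm_def]; exact PadicInt.norm_le_one m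
  have n4mul : ∀ m : ℤ_[2], ‖((4 * m : ℤ_[2]) : ℚ_[2])‖ ≤ 1 / 4 := fun m => by
    rw [show (4 * m : ℤ_[2]) = 2 * (2 * m) by ring]; push_cast
    rw [norm_mul, norm_mul, h2n]
    nlinarith [hm1 m, norm_nonneg (m : ℚ_[2])]
  have n8mul : ∀ m : ℤ_[2], ‖((8 * m : ℤ_[2]) : ℚ_[2])‖ ≤ 1 / 8 := fun m => by
    rw [show (8 * m : ℤ_[2]) = 2 * (2 * (2 * m)) by ring]; push_cast
    rw [norm_mul, norm_mul, norm_mul, h2n]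
    nlinarith [hm1 m, norm_nonneg (m : ℚ_[2])]
  have padicTwo_norm_le_half_of_lt_one : ∀ {x : ℚ_[2]}, ‖x‖ < 1 → ‖x‖ ≤ 1 / 2 := fun {x} h => by
    have := (Padic.norm_le_pow_iff_norm_lt_pow_add_one x (-1)).mpr (by norm_num; exact h)
    norm_num at this; exact this
  set B₂ : ℤ_[2] := α ^ 2 + 4 * α₂ with hB₂
  set B₄ : ℤ_[2] := 4 * (2 * α₄ + α * α₃) with hB₄
  set B₆ : ℤ_[2] := 4 * (α₃ ^ 2 + 4 * α₆) with hB₆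
  have nB₂ : ‖(B₂ : ℚ_[2])‖ ≤ 1 := PadicInt.norm_le_one _
  have nB₄ : ‖(B₄ : ℚ_[2])‖ ≤ 1 / 4 := by rw [hB₄]; exact n4mul _
  have nB₆ : ‖(B₆ : ℚ_[2])‖ ≤ 1 / 4 := by rw [hB₆]; exact n4mul _
  have nB₆' : 1 / 8 < ‖(B₆ : ℚ_[2])‖ := by
    have hδu : IsUnit (α₃ ^ 2 + 4 * α₆) := by
      by_contra hnu
      have hm : α₃ ^ 2 + 4 * α₆ ∈ RingHom.ker (PadicInt.toZMod (p := 2)) := by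
        rw [PadicInt.ker_toZMod]; exact (IsLocalRing.mem_maximalIdeal _).mpr hnu
      rw [RingHom.mem_ker, map_add, map_mul, map_pow, map_ofNat, toZMod_eq_one_of_isUnit hα₃] at hm
      revert hm; generalize PadicInt.toZMod (p := 2) α₆ = z; revert z; decide
    have hδ1 : ‖((α₃ ^ 2 + 4 * α₆ : ℤ_[2]) : ℚ_[2])‖ = 1 := by
      rw [← PadicInt.norm_def]; exact PadicInt.isUnit_iff.mp hδu
    rw [hB₆, show (4 * (α₃ ^ 2 + 4 * α₆) : ℤ_[2]) = 2 * (2 * (α₃ ^ 2 + 4 * α₆)) by ring]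
    push_cast [PadicInt.coe_mul] at hδ1 ⊢
    rw [norm_mul, norm_mul, h2n, hδ1]; norm_num
  have hle : ‖t‖ ≤ 1 := padic_norm_le_one_of_monic_cubic_root nB₂ (by linarith) (by linarith) ht
  -- (i) no root with `‖t‖ ≤ 1/4`
  have hsmall : ¬ ‖t‖ ≤ 1 / 4 := by
    intro hle4
    refine padic_add_ne_zero_of_norm_lt (a := (B₆ : ℚ_[2])) (b := t ^ 3 + (B₂ : ℚ_[2]) * t ^ 2 + (B₄ : ℚ_[2]) * t)
      (padic_norm_add3_lt ?_ ?_ ?_) (by rw [← ht]; ring)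
    · rw [norm_pow]
      calc ‖t‖ ^ 3 ≤ (1 / 4) ^ 3 := by gcongr
        _ < 1 / 8 := by norm_num
        _ < _ := nB₆'
    · rw [norm_mul, norm_pow]
      calc ‖(B₂ : ℚ_[2])‖ * ‖t‖ ^ 2 ≤ 1 * (1 / 4) ^ 2 := by gcongr
        _ < 1 / 8 := by norm_num
        _ < _ := nB₆'
    · rw [norm_mul]
      calc ‖(B₄ : ℚ_[2])‖ * ‖t‖ ≤ (1 / 4) * (1 / 4) := by gcongr
        _ < 1 / 8 := by norm_num
        _ < _ := nB₆'
  by_cases hα : ¬ IsUnit α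
  · -- `2 ∣ α`: no root at all
    exfalso
    obtain ⟨β, hβ⟩ := padicInt_two_eq_two_mul_of_not_isUnit hα
    have nB₂' : ‖(B₂ : ℚ_[2])‖ ≤ 1 / 4 := by
      rw [hB₂, hβ, show ((2 * β) ^ 2 + 4 * α₂ : ℤ_[2]) = 4 * (β ^ 2 + α₂) by ring]; exact n4mul _
    have nB₄' : ‖(B₄ : ℚ_[2])‖ ≤ 1 / 8 := by
      rw [hB₄, hβ, show (4 * (2 * α₄ + 2 * β * α₃) : ℤ_[2]) = 8 * (α₄ + β * α₃) by ring]; exact n8mul _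
    rcases hle.lt_or_eq with hlt | heq
    · have hx2 := padicTwo_norm_le_half_of_lt_one hlt
      refine padic_add_ne_zero_of_norm_lt (a := (B₆ : ℚ_[2]))
        (b := t ^ 3 + (B₂ : ℚ_[2]) * t ^ 2 + (B₄ : ℚ_[2]) * t) (padic_norm_add3_lt ?_ ?_ ?_) (by rw [← ht]; ring)
      · rw [norm_pow]
        calc ‖t‖ ^ 3 ≤ (1 / 2) ^ 3 := by gcongr
          _ = 1 / 8 := by norm_num
          _ < _ := nB₆'
      · rw [norm_mul, norm_pow]
        calc ‖(B₂ : ℚ_[2])‖ * ‖t‖ ^ 2 ≤ (1 / 4) * (1 / 2) ^ 2 := by gcongr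
          _ < 1 / 8 := by norm_num
          _ < _ := nB₆'
      · rw [norm_mul]
        calc ‖(B₄ : ℚ_[2])‖ * ‖t‖ ≤ (1 / 8) * (1 / 2) := by gcongr
          _ < 1 / 8 := by norm_num
          _ < _ := nB₆'
    · refine padic_add_ne_zero_of_norm_lt (a := t ^ 3)
        (b := (B₂ : ℚ_[2]) * t ^ 2 + (B₄ : ℚ_[2]) * t + (B₆ : ℚ_[2])) ?_ (by rw [← ht]; ring)
      rw [norm_pow, heq, one_pow]
      refine padic_norm_add3_lt ?_ ?_ ?_
      · rw [norm_mul, norm_pow, heq, one_pow, mul_one]; linarith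
      · rw [norm_mul, heq, mul_one]; linarith
      · linarith
  · -- `α` a unit: `‖t‖ = 1/2` is impossible (mod `4`), so `‖t‖ = 1`
    rw [not_not] at hα
    have hhalf : ‖t‖ ≠ 1 / 2 := by
      intro hn
      have h2 : ‖(2 : ℚ_[2])‖ = 1 / 2 := by
        have := Padic.norm_p (p := 2); norm_num at this ⊢; exact_mod_cast this
      have hwn : ‖t / 2‖ = 1 := by rw [norm_div, hn, h2]; norm_num
      set w : ℤ_[2] := ⟨t / 2, hwn.le⟩ with hwdef
      have hwu : IsUnit w := PadicInt.isUnit_iff.mpr (by rw [PadicInt.norm_def]; exact hwn)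
      have htw : t = 2 * (w : ℚ_[2]) := by show t = 2 * (t / 2); ring
      set γ : ℤ_[2] := 2 * α₄ + α * α₃ with hγ
      set δ : ℤ_[2] := α₃ ^ 2 + 4 * α₆ with hδ
      set gz : ℤ_[2] := 2 * w ^ 3 + (B₂ : ℤ_[2]) * w ^ 2 + 2 * (γ : ℤ_[2]) * w + (δ : ℤ_[2]) with hgz
      have hgzQ : (gz : ℚ_[2]) = 2 * (w : ℚ_[2]) ^ 3 + (B₂ : ℚ_[2]) * (w : ℚ_[2]) ^ 2 +
          2 * (γ : ℚ_[2]) * (w : ℚ_[2]) + (δ : ℚ_[2]) := by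
        have c2 : ((2 : ℤ_[2]) : ℚ_[2]) = 2 := by exact_mod_cast PadicInt.coe_natCast 2
        rw [hgz]; push_cast; simp only [c2]
      have c4 : ((4 : ℤ_[2]) : ℚ_[2]) = 4 := by exact_mod_cast PadicInt.coe_natCast 4
      have cB₄ : (B₄ : ℚ_[2]) = 4 * (γ : ℚ_[2]) := by rw [hB₄, hγ]; push_cast; simp only [c4]
      have cB₆ : (B₆ : ℚ_[2]) = 4 * (δ : ℚ_[2]) := by rw [hB₆, hδ]; push_cast; simp only [c4]
      have hg : gz = 0 := by
        have h4 : (4 : ℚ_[2]) ≠ 0 := by norm_num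
        have e : (4 : ℚ_[2]) * (gz : ℚ_[2]) = t ^ 3 + (B₂ : ℚ_[2]) * t ^ 2 + (B₄ : ℚ_[2]) * t + (B₆ : ℚ_[2]) := by
          rw [hgzQ, cB₄, cB₆, htw]; ring
        rw [ht] at e
        exact PadicInt.coe_eq_zero.mp ((mul_eq_zero.mp e).resolve_left h4)
      have hmod := congrArg (PadicInt.toZModPow (p := 2) 2) hg
      rw [hgz, map_zero] at hmod
      rw [hB₂, hγ, hδ] at hmod
      simp only [map_add, map_mul, map_pow, map_ofNat] at hmod
      set F := PadicInt.toZModPow (p := 2) 2 with hF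
      have h4z : (4 : ZMod (2 ^ 2)) = 0 := by decide
      have hred : (2 * F w ^ 3 + F α ^ 2 * F w ^ 2 + 2 * (F α * F α₃) * F w + F α₃ ^ 2 : ZMod (2 ^ 2)) = 0 := by
        rw [← hmod]
        linear_combination (-(F α₂) * F w ^ 2 - F α₄ * F w - F α₆) * h4z
      obtain hw | hw := toZModPow_two_of_isUnit hwu <;>
        obtain ha | ha := toZModPow_two_of_isUnit hα <;>
          obtain ha3 | ha3 := toZModPow_two_of_isUnit hα₃ <;>
            · rw [show (F w : ZMod (2 ^ 2)) = _ from hw, show (F α : ZMod (2 ^ 2)) = _ from ha,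
                show (F α₃ : ZMod (2 ^ 2)) = _ from ha3] at hred
              revert hred; decide
    rcases hle.lt_or_eq with hlt | heq
    · exfalso
      have h2 := padicTwo_norm_le_half_of_lt_one hlt
      rcases h2.lt_or_eq with hlt2 | heq2
      · exact hsmall (padicTwo_norm_le_quarter_of_lt_half hlt2)
      · exact hhalf heq2
    · exact heq

/-- On the `IV*` normal form the Vélu quantity `3x² + 2(α² + 4α₂)x + 4(2α₄ + αα₃)` at a UNIT `x ∈ ℤ₂` is a unit (it is odd).
[folklore] -/
theorem isUnit_veluB_IVstarNormalForm {α α₂ α₃ α₄ : ℤ_[2]} {x : ℤ_[2]} (hx : IsUnit x) :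
    IsUnit (3 * x ^ 2 + 2 * (α ^ 2 + 4 * α₂) * x + 4 * (2 * α₄ + α * α₃)) := by
  by_contra hnu
  have hm : 3 * x ^ 2 + 2 * (α ^ 2 + 4 * α₂) * x + 4 * (2 * α₄ + α * α₃) ∈ RingHom.ker (PadicInt.toZMod (p := 2)) := by
    rw [PadicInt.ker_toZMod]; exact (IsLocalRing.mem_maximalIdeal _).mpr hnu
  rw [RingHom.mem_ker] at hm
  simp only [map_add, map_mul, map_pow, map_ofNat, toZMod_eq_one_of_isUnit hx] at hm
  revert hm
  generalize PadicInt.toZMod (p := 2) α = a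
  generalize PadicInt.toZMod (p := 2) α₂ = b
  generalize PadicInt.toZMod (p := 2) α₃ = c
  generalize PadicInt.toZMod (p := 2) α₄ = d
  revert a b c d; decide


/-! ### §2 A globally minimal model is `ℤ_p`-minimal, keyed by the prime -/

/-- By-`p` repackaging of `isMinimal_baseChange_padic_of_isGloballyMinimal`. [cite: SilvermanAEC2009, VIII.8] -/
theorem isMinimal_baseChange_padic_of_isGloballyMinimal' (W : WeierstrassCurve ℚ) [W.IsGloballyMinimal]
    (p : ℕ) [hp : Fact p.Prime] : (W.baseChange ℚ_[p]).IsMinimal ℤ_[p] := by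
  obtain ⟨v, hv⟩ := (Rat.HeightOneSpectrum.primesEquiv (R := NumberField.RingOfIntegers ℚ)).surjective ⟨p, hp.out⟩
  have hvp : ((Rat.HeightOneSpectrum.primesEquiv v : Nat.Primes) : ℕ) = p := congrArg Subtype.val hv
  subst hvp
  exact isMinimal_baseChange_padic_of_isGloballyMinimal W v

/-! ### §3 The Vélu `B` of a rational `2`-torsion point on a tame `IV*` curve is a `2`-adic unit -/

/-- **E-an-120, `IV*` half, valuation form (cell bsd-f2-manin, MEMO-an §67: `IV*`: `m = 7`, `K = 8`; census 32 073 / 0):** on a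
globally minimal `W/ℚ`, TAME at `2` (`4 ∥ N`) with `ord₂ Δ_min = 8` (Kodaira `IV*`), for every `q ∈ ℚ` with `Ψ₂²_W(q − b₂/12) = 0`
(a rational `2`-torsion abscissa read on the short model) the Vélu quantity `B = 3q² − c₄/48` has `‖B‖₂ = 1`.
[cite: SilvermanATAEC1994, IV.9.4 (steps 2, 6, 8) and Table 4.1] [cite: SilvermanAEC2009, III.1 Table 3.1] -/
theorem norm_veluB_eq_one_of_IVstar (W : WeierstrassCurve ℚ) [W.IsElliptic] [W.IsGloballyMinimal]
    (h4 : 2 ^ 2 ∣ W.conductorNorm ℤ) (h8 : ¬ 2 ^ 3 ∣ W.conductorNorm ℤ)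
    (hΔ8 : padicValInt 2 W.minimalDiscriminantInt = 8) (q : ℚ) (hq : W.Ψ₂Sq.eval (q - W.b₂ / 12) = 0) :
    ‖((3 * q ^ 2 - W.c₄ / 48 : ℚ) : ℚ_[2])‖ = 1 := by
  -- Kodaira `IV*` at the place of `ℤ` above `2`, read over `ℤ₂` (the lead's E-imc-75 pipeline)
  set v : IsDedekindDomain.HeightOneSpectrum ℤ := (Rat.HeightOneSpectrum.primesEquiv (R := ℤ)).symm ⟨2, Nat.prime_two⟩
    with hvdef
  have hv : Rat.HeightOneSpectrum.natGenerator v = 2 :=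
    Literature.NumberTheory.EllipticCurves.Rat.natGenerator_primesEquiv_symm ⟨2, Nat.prime_two⟩
  have hK : W.kodairaSymbolAt v = .IVstar := by
    rcases W.kodairaSymbolAt_of_four_dvd_conductorNorm v hv h4 h8 with ⟨-, h⟩ | ⟨h, -⟩
    · rw [hΔ8] at h; norm_num at h
    · exact h
  have e : Rat.HeightOneSpectrum.primesEquiv (R := ℤ) v = ⟨2, Nat.prime_two⟩ := Equiv.apply_symm_apply _ _
  have hKp := WeierstrassCurve.kodairaSymbolAt_eq_padic (R := ℤ) v W
  rw [e] at hKp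
  change W.kodairaSymbolAt v = (((W.baseChange ℚ_[2]).minimal ℤ_[2]).integralModel ℤ_[2]).kodairaSymbolOfMinimal at hKp
  rw [hK] at hKp
  set X : WeierstrassCurve ℚ_[2] := W.baseChange ℚ_[2] with hX
  set V₀ : WeierstrassCurve ℤ_[2] := (X.minimal ℤ_[2]).integralModel ℤ_[2] with hV₀
  obtain ⟨D, α, α₂, α₃, α₄, α₆, h₁, h₂, h₃, hα₃, h₄', h₆⟩ := exists_IVstarNormalForm_padicInt V₀ hKp.symm
  set E : WeierstrassCurve.VariableChange ℚ_[2] := (X.exists_isMinimal ℤ_[2]).choose with hE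
  have hmin : X.minimal ℤ_[2] = E • X := rfl
  have hV₀X : V₀.baseChange ℚ_[2] = X.minimal ℤ_[2] := WeierstrassCurve.baseChange_integralModel_eq ℤ_[2] _
  set Ctot : WeierstrassCurve.VariableChange ℚ_[2] := D.map (algebraMap ℤ_[2] ℚ_[2]) * E with hCtot
  have hCX : Ctot • X = (D • V₀).map (algebraMap ℤ_[2] ℚ_[2]) := by
    rw [hCtot, mul_smul, ← hmin, ← hV₀X]
    exact WeierstrassCurve.map_variableChange _ _ _
  have halg : algebraMap ℤ_[2] ℚ_[2] = PadicInt.Coe.ringHom := rfl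
  have hrat : ∀ r : ℚ, algebraMap ℚ ℚ_[2] r = (r : ℚ_[2]) := fun r => by rw [eq_ratCast]
  have hXb₂ : X.b₂ = (W.b₂ : ℚ_[2]) := by rw [hX, WeierstrassCurve.baseChange, map_b₂, hrat]
  have hXb₄ : X.b₄ = (W.b₄ : ℚ_[2]) := by rw [hX, WeierstrassCurve.baseChange, map_b₄, hrat]
  have hXb₆ : X.b₆ = (W.b₆ : ℚ_[2]) := by rw [hX, WeierstrassCurve.baseChange, map_b₆, hrat]
  have hXΔ : X.Δ = (W.Δ : ℚ_[2]) := by rw [hX, WeierstrassCurve.baseChange, map_Δ, hrat]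
  -- the torsion abscissa `t = q − b₂/12` over `ℚ₂`
  set t : ℚ_[2] := ((q - W.b₂ / 12 : ℚ) : ℚ_[2]) with ht
  have hqQ : 4 * (q - W.b₂ / 12) ^ 3 + W.b₂ * (q - W.b₂ / 12) ^ 2 + 2 * W.b₄ * (q - W.b₂ / 12) + W.b₆ = 0 := by
    simp only [WeierstrassCurve.Ψ₂Sq, eval_add, eval_mul, eval_pow, eval_C, eval_X] at hq
    linear_combination hq
  have htX : 4 * t ^ 3 + X.b₂ * t ^ 2 + 2 * X.b₄ * t + X.b₆ = 0 := by
    have h0 := congrArg (fun r : ℚ ↦ ((r : ℚ) : ℚ_[2])) hqQ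
    simp only [Rat.cast_add, Rat.cast_mul, Rat.cast_pow, Rat.cast_ofNat, Rat.cast_zero] at h0
    rw [hXb₂, hXb₄, hXb₆, ht]
    exact h0
  -- the transported root of the `IV*`-cubic is a unit
  set x₁ : ℚ_[2] := ((Ctot.u⁻¹ : ℚ_[2]ˣ) : ℚ_[2]) ^ 2 * (t - Ctot.r) with hx₁
  have hroot : x₁ ^ 3 + ((α ^ 2 + 4 * α₂ : ℤ_[2]) : ℚ_[2]) * x₁ ^ 2 +
      ((4 * (2 * α₄ + α * α₃) : ℤ_[2]) : ℚ_[2]) * x₁ + ((4 * (α₃ ^ 2 + 4 * α₆) : ℤ_[2]) : ℚ_[2]) = 0 := by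
    have h := twoDivision_root_smul X Ctot htX
    rw [hCX, halg] at h
    exact IVstarCubic_eq_zero_of_twoDivision_root (D • V₀) h₁ h₂ h₃ h₄' h₆ h
  have hx₁n : ‖x₁‖ = 1 := norm_eq_one_of_IVstarCubic_root_padicInt hα₃ hroot
  set xz : ℤ_[2] := ⟨x₁, hx₁n.le⟩ with hxz
  have hxu : IsUnit xz := PadicInt.isUnit_iff.mpr (by rw [PadicInt.norm_def]; exact hx₁n)
  have hBNFu := isUnit_veluB_IVstarNormalForm (α := α) (α₂ := α₂) (α₃ := α₃) (α₄ := α₄) hxu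
  have hBNFn : ‖((3 * xz ^ 2 + 2 * (α ^ 2 + 4 * α₂) * xz + 4 * (2 * α₄ + α * α₃) : ℤ_[2]) : ℚ_[2])‖ = 1 := by
    rw [← PadicInt.norm_def]; exact PadicInt.isUnit_iff.mp hBNFu
  -- `B` read on the normal form
  have c2 : ((2 : ℤ_[2]) : ℚ_[2]) = 2 := by exact_mod_cast PadicInt.coe_natCast 2
  have c3 : ((3 : ℤ_[2]) : ℚ_[2]) = 3 := by exact_mod_cast PadicInt.coe_natCast 3
  have c4 : ((4 : ℤ_[2]) : ℚ_[2]) = 4 := by exact_mod_cast PadicInt.coe_natCast 4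
  have c8 : ((8 : ℤ_[2]) : ℚ_[2]) = 8 := by exact_mod_cast PadicInt.coe_natCast 8
  have ev : ∀ z : ℤ_[2], (PadicInt.Coe.ringHom (p := 2)) z = (z : ℚ_[2]) := fun z => rfl
  have hb₂' : (Ctot • X).b₂ = ((4 * (α ^ 2 + 4 * α₂) : ℤ_[2]) : ℚ_[2]) := by
    rw [hCX]
    simp only [WeierstrassCurve.b₂, map_a₁, map_a₂, h₁, h₂, halg, ev]
    push_cast
    simp only [c2, c4]
    ring
  have hb₄' : (Ctot • X).b₄ = ((8 * (2 * α₄ + α * α₃) : ℤ_[2]) : ℚ_[2]) := by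
    rw [hCX]
    simp only [WeierstrassCurve.b₄, map_a₁, map_a₃, map_a₄, h₁, h₃, h₄', halg, ev]
    push_cast
    simp only [c2, c4, c8]
    ring
  have hBtrans : ((3 * q ^ 2 - W.c₄ / 48 : ℚ) : ℚ_[2]) =
      ((Ctot.u : ℚ_[2]ˣ) : ℚ_[2]) ^ 4 * ((6 * x₁ ^ 2 + (Ctot • X).b₂ * x₁ + (Ctot • X).b₄) / 2) := by
    rw [variableChange_b₂, variableChange_b₄, hx₁, hXb₂, hXb₄, ht]
    simp only [Units.val_inv_eq_inv_val]
    have hu0 : ((Ctot.u : ℚ_[2]ˣ) : ℚ_[2]) ≠ 0 := Units.ne_zero _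
    have hc : (W.c₄ : ℚ_[2]) = (W.b₂ : ℚ_[2]) ^ 2 - 24 * (W.b₄ : ℚ_[2]) := by
      rw [show W.c₄ = W.b₂ ^ 2 - 24 * W.b₄ from rfl]; push_cast; ring
    push_cast
    rw [hc]
    field_simp
    ring
  have hBNF : (6 * x₁ ^ 2 + (Ctot • X).b₂ * x₁ + (Ctot • X).b₄) / 2 =
      ((3 * xz ^ 2 + 2 * (α ^ 2 + 4 * α₂) * xz + 4 * (2 * α₄ + α * α₃) : ℤ_[2]) : ℚ_[2]) := by
    rw [hb₂', hb₄']
    have exz : ((xz : ℤ_[2]) : ℚ_[2]) = x₁ := rfl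
    push_cast
    simp only [c2, c3, c4, c8, exz]
    ring
  -- `‖u‖ = 1`: both `X` and `Ctot • X` have `ord₂ Δ = 8`
  haveI : X.IsMinimal ℤ_[2] := isMinimal_baseChange_padic_of_isGloballyMinimal' W 2
  have hXΔ0 : X.Δ ≠ 0 := by
    rw [hXΔ]; exact_mod_cast (show W.Δ ≠ 0 by rw [← WeierstrassCurve.coe_Δ']; exact W.Δ'.ne_zero)
  have hminΔ : (X.minimal ℤ_[2]).Δ ≠ 0 := by
    rw [hmin, variableChange_Δ]; exact mul_ne_zero (pow_ne_zero _ (Units.ne_zero _)) hXΔ0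
  have hnormmin : ‖(X.minimal ℤ_[2]).Δ‖ = ‖X.Δ‖ := by
    rw [Padic.norm_eq_zpow_neg_valuation hminΔ, Padic.norm_eq_zpow_neg_valuation hXΔ0,
      padicValuation_Δ_minimal_eq X hXΔ0]
  have hΔNF : (Ctot • X).Δ = ((((D.u⁻¹ : ℤ_[2]ˣ) : ℤ_[2]) ^ 12 * V₀.Δ : ℤ_[2]) : ℚ_[2]) := by
    rw [hCX, map_Δ, variableChange_Δ, halg]; rfl
  have hV₀Δ : ((V₀.Δ : ℤ_[2]) : ℚ_[2]) = (X.minimal ℤ_[2]).Δ := by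
    rw [← hV₀X, WeierstrassCurve.baseChange, map_Δ, halg]; rfl
  have hnormNF : ‖(Ctot • X).Δ‖ = ‖X.Δ‖ := by
    rw [hΔNF]; push_cast
    rw [norm_mul, norm_pow, hV₀Δ, hnormmin]
    have hDu : ‖(((D.u⁻¹ : ℤ_[2]ˣ) : ℤ_[2]) : ℚ_[2])‖ = 1 := by
      rw [← PadicInt.norm_def]; exact PadicInt.isUnit_iff.mp (Units.isUnit _)
    rw [hDu, one_pow, one_mul]
  have hun : ‖((Ctot.u : ℚ_[2]ˣ) : ℚ_[2])‖ = 1 := by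
    have h := hnormNF
    rw [variableChange_Δ, norm_mul, norm_pow] at h
    have hX0 : ‖X.Δ‖ ≠ 0 := norm_ne_zero_iff.mpr hXΔ0
    have h12 : ‖((Ctot.u⁻¹ : ℚ_[2]ˣ) : ℚ_[2])‖ ^ 12 = 1 := by
      have := mul_right_cancel₀ hX0 (h.trans (one_mul _).symm)
      exact this
    have h1 : ‖((Ctot.u⁻¹ : ℚ_[2]ˣ) : ℚ_[2])‖ = 1 :=
      (pow_eq_one_iff_of_nonneg (norm_nonneg _) (by norm_num)).mp h12
    rw [Units.val_inv_eq_inv_val, norm_inv, inv_eq_one] at h1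
    exact h1
  -- conclusion
  rw [hBtrans, hBNF, norm_mul, norm_pow, hun, one_pow, one_mul, hBNFn]

/-- **`ord₂ B = 0` on the `IV*` stratum** (`B = 3q² − c₄/48` at a rational `2`-torsion abscissa of a tame `IV*` curve).
[cite: SilvermanATAEC1994, IV.9.4 and Table 4.1] -/
theorem padicValRat_veluB_eq_zero_of_IVstar (W : WeierstrassCurve ℚ) [W.IsElliptic] [W.IsGloballyMinimal]
    (h4 : 2 ^ 2 ∣ W.conductorNorm ℤ) (h8 : ¬ 2 ^ 3 ∣ W.conductorNorm ℤ)
    (hΔ8 : padicValInt 2 W.minimalDiscriminantInt = 8) (q : ℚ) (hq : W.Ψ₂Sq.eval (q - W.b₂ / 12) = 0) :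
    padicValRat 2 (3 * q ^ 2 - W.c₄ / 48) = 0 := by
  have h := norm_veluB_eq_one_of_IVstar W h4 h8 hΔ8 q hq
  by_cases h0 : (3 * q ^ 2 - W.c₄ / 48 : ℚ) = 0
  · rw [h0]; simp
  rw [Padic.eq_padicNorm, padicNorm.eq_zpow_of_nonzero h0] at h
  have h' : ((2 : ℚ) : ℝ) ^ (-padicValRat 2 (3 * q ^ 2 - W.c₄ / 48)) = 1 := by exact_mod_cast h
  have := (zpow_eq_one_iff_right₀ (by norm_num : (0 : ℝ) ≤ 2) (by norm_num : ((2 : ℚ) : ℝ) ≠ 1)).mp h'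
  omega

end Summit.BirchSwinnertonDyer.BirchSwinnertonDyer.Theorems.ManinLocalTwoThree

end
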